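/-
Copyright (c) 2026. All rights reserved.
Released under Apache 2.0 license as described in the file LICENSE.
-/
import Literature.NumberTheory.ComplexMultiplication.DegenerateCMTypesCyclicPrimePowerCount
import Literature.AlgebraicGeometry.Pohlmann1968.DegenerateCMTypesCyclicCMFieldPrimePowerExistence
import HarnessLib

/-!
# CM fields with Galois group `⟨ρ⟩ × ℤ_{p^k}`: the number of CM types, of non-primitive and of primitive ones,
# and of those equidistributed at each level — `ℚ(ζ₈₁)`: `2²⁷` types, `512` non-primitive

Number-field dress of `NumberTheory/ComplexMultiplication/DegenerateCMTypesCyclicPrimePowerCount` (the counts of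
the CM types of `⟨ρ⟩ × ℤ_{p^k}` by levels) through the transport `Φ ↦ {g : σ_g ∈ Φ}` of
`DegenerateCMTypesCyclicCMFieldPrimeSquare.ncard_cmType_sep_eq`.  B. Dodson [Dodson1987], Prop. 4.4 (1) (`⟨ρ⟩ × ℤ₉`:
`512` types, `8` imprimitive), Remark 4.5; F. Hazama [Hazama2003CyclicCM], Prop. 4.3, Thm. 4.8.
THEOREMS ONLY (no definition, no named fact, no `sorry`).

## What is proved

* §1 (`K` normal with commutative group, `σ` of order `p^k`, `[K : ℚ] = 2p^k`, `p` odd): **`ncard_cmType`**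
  (`2^{p^k}` CM types), **`ncard_level`** (`(Σ_m C(p^{k−i−1}, m)^p)^{p^i}` equidistributed at level `i + 1`),
  **`ncard_not_isPrimitive`** (`2^{p^{k−1}}`), **`ncard_isPrimitive`** (`2^{p^k} − 2^{p^{k−1}}`),
  `exists_isPrimitive_not_isNondegenerate` (`k ≥ 2`: a primitive degenerate type of rank `φ(p^k) + 2`).
* §2 cyclic Galois group of order `2p^k`: **`counts_of_isCyclic`**; degree `54` and `ℚ(ζ₈₁)`:
  **`counts_of_isCyclic_fiftyFour`**, **`counts_eightyOne`** (`134217728` CM types, `512` non-primitive,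
  `134217216` primitive).

NOT here: the number of NONDEGENERATE types for `k ≥ 3` (joint distribution of the levels).

## References

* [Dodson1987] B. Dodson, J. Algebra 111 (1987) 49–73: §1.1, Prop. 4.1, Prop. 4.4 (1), Remark 4.5.
* [Hazama2003CyclicCM] F. Hazama, J. Math. Sci. Univ. Tokyo 10 (2003): Prop. 4.3, Thm. 4.8.
* [Shimura1998] G. Shimura, §8.1, §8.2 Prop. 26.
* [Washington1997] L. Washington, Thm. 2.5.

## Provenance

Lane `lit-hodgefound` (Track 2, Layer A3/B), seat `lit-hodgefound-p10` generation 35, row g35-#14; neighbours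
cited by name, nothing restated: `DegenerateCMTypesCyclicPrimePowerCount` (`ncard_cmTypes`, `ncard_level`,
`ncard_isStableUnder`, `ncard_primitive`), `DegenerateCMTypesCyclicCMFieldPrimePower(Existence)` (frame,
`isPrimitive_iff_not_isStableUnder`, `exists_isPrimitive_cmTypeRank_eq_min`, `cm_normal_cyclic_finrank_eightyOne`),
`DegenerateCMTypesCyclicCMFieldPrimeSquare` (`ncard_cmType_sep_eq`).
-/

open scoped BigOperators NumberField IsMulCommutative Classical
open CategoryTheory NumberField

namespace Literature.AlgebraicGeometry.Pohlmann1968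

namespace CyclicPrimePower

open Literature.NumberTheory.ComplexMultiplication
open Literature.NumberTheory.ComplexMultiplication.CyclicCMType
open Literature.NumberTheory.ComplexMultiplication.CyclicCMType.PrimePow
open Literature.AlgebraicGeometry.Motives (AbelianVariety CMType)
open Literature.AlgebraicGeometry.HodgeTheory
open Literature.AlgebraicGeometry.ComplexMultiplication (IsCMTypeRealisation isSimple_iff_isPrimitive
  isPrimitive_ringEquiv_complex_iff exists_isCMTypeRealisation)
open Literature.AlgebraicGeometry.Pohlmann1968.CyclicTwoOddPrimes (gal_comm isCMTypeWith_galType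
  cmTypeRank_eq_typeRank_galType mem_galType_iff exists_cmType_of_isCMTypeWith)
open Literature.AlgebraicGeometry.Pohlmann1968.CyclicPrimeSquare (ncard_cmType_sep_eq)

/-! ## §1 Counting the CM types of `K` -/

section Counts

variable {K : Type} [Field K] [NumberField K] [IsCMField K] [Normal ℚ K] [IsMulCommutative (K ≃ₐ[ℚ] K)]
variable {p : ℕ} [hp : Fact p.Prime] {k : ℕ} {ρ σ : K ≃ₐ[ℚ] K} {φ₀ : K →+* ℂ}

/-- **`K` has `2^{p^k}` CM types** (`2²⁷ = 134217728` for the cyclic CM fields of degree `54`).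
[cite: Dodson1987, §1.1 and Prop. 4.1] [cite: Shimura1998, §8.1] -/
theorem ncard_cmType (hp2 : p ≠ 2) (hρ : ∀ x, φ₀ (ρ x) = starRingEnd ℂ (φ₀ x)) (hσ : orderOf σ = p ^ k)
    (hK : Module.finrank ℚ K = 2 * p ^ k) : (Set.univ : Set (CMType K)).ncard = 2 ^ (p ^ k) := by
  have h := ncard_cmType_sep_eq hρ (fun _ => True) (fun _ => True) fun _ => Iff.rfl
  simp only [Set.setOf_true, and_true] at h
  rw [h]
  exact PrimePow.ncard_cmTypes hσ (rho_not_mem_zpowers hp2 hρ hσ) (card_gal_eq φ₀ hK) (conjGalElt_mul_self hρ)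

/-- **The CM types of `K` equidistributed at level `i + 1` number `(Σ_m C(p^{k−i−1}, m)^p)^{p^i}`** — those on
which the `φ(p^{i+1})` odd characters of `Gal(K/ℚ)` of order `2p^{i+1}` vanish.
[cite: Hazama2003CyclicCM, Prop. 4.3 and Thm. 4.8] [cite: Dodson1987, Prop. 4.4 (1)] -/
theorem ncard_level (hp2 : p ≠ 2) (hρ : ∀ x, φ₀ (ρ x) = starRingEnd ℂ (φ₀ x)) (hσ : orderOf σ = p ^ k)
    (hK : Module.finrank ℚ K = 2 * p ^ k) {i : ℕ} (hi : i < k) :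
    {Φ : CMType K | ∀ c : ZMod (p ^ (i + 1)),
      rowCount (p ^ (k - (i + 1))) (p ^ (i + 1)) (Finset.univ.filter fun g : K ≃ₐ[ℚ] K => embOf φ₀ g ∈ Φ.1)
          (σ ^ p ^ (i + 1)) σ (c + (p ^ i : ℕ)) =
        rowCount (p ^ (k - (i + 1))) (p ^ (i + 1)) (Finset.univ.filter fun g : K ≃ₐ[ℚ] K => embOf φ₀ g ∈ Φ.1)
          (σ ^ p ^ (i + 1)) σ c}.ncard =
      (∑ m ∈ Finset.range (p ^ (k - (i + 1)) + 1), (p ^ (k - (i + 1))).choose m ^ p) ^ (p ^ i) := by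
  rw [← PrimePow.ncard_level hσ (rho_not_mem_zpowers hp2 hρ hσ) (card_gal_eq φ₀ hK) (conjGalElt_mul_self hρ) hi]
  exact ncard_cmType_sep_eq hρ _ _ fun Φ => Iff.rfl

/-- **The NON-PRIMITIVE CM types of `K` number `2^{p^{k−1}}`** (`k = m + 1 ≥ 1`; `512` in degree `54`): those
induced from the CM subfield of degree `2p^{k−1}`. [cite: Dodson1987, Prop. 4.4 (1)] [cite: Shimura1998, §8.2 Prop. 26] -/
theorem ncard_not_isPrimitive (hp2 : p ≠ 2) (hρ : ∀ x, φ₀ (ρ x) = starRingEnd ℂ (φ₀ x)) {m : ℕ}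
    (hσ : orderOf σ = p ^ (m + 1)) (hK : Module.finrank ℚ K = 2 * p ^ (m + 1)) (φh : K →+* ℂ) :
    {Φ : CMType K | ¬ IsPrimitive (ℂ ≃+* ℂ) Φ.1 φh}.ncard = 2 ^ (p ^ m) := by
  rw [← PrimePow.ncard_isStableUnder hp2 hσ (rho_not_mem_zpowers hp2 hρ hσ) (card_gal_eq φ₀ hK)
    (conjGalElt_mul_self hρ)]
  refine ncard_cmType_sep_eq hρ _ _ fun Φ => ?_
  rw [isPrimitive_iff_not_isStableUnder hp2 hρ hσ hK Φ φh, not_not]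

/-- **The PRIMITIVE CM types of `K` number `2^{p^k} − 2^{p^{k−1}}`** (`134217216` in degree `54`) — each the type
of simple abelian `p^k`-folds. [cite: Dodson1987, Prop. 4.4 (1)] [cite: Shimura1998, §8.2 Prop. 26] -/
theorem ncard_isPrimitive (hp2 : p ≠ 2) (hρ : ∀ x, φ₀ (ρ x) = starRingEnd ℂ (φ₀ x)) {m : ℕ}
    (hσ : orderOf σ = p ^ (m + 1)) (hK : Module.finrank ℚ K = 2 * p ^ (m + 1)) (φh : K →+* ℂ) :
    {Φ : CMType K | IsPrimitive (ℂ ≃+* ℂ) Φ.1 φh}.ncard = 2 ^ (p ^ (m + 1)) - 2 ^ (p ^ m) := by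
  rw [← PrimePow.ncard_primitive hp2 hσ (rho_not_mem_zpowers hp2 hρ hσ) (card_gal_eq φ₀ hK)
    (conjGalElt_mul_self hρ)]
  exact ncard_cmType_sep_eq hρ _ _ fun Φ => CyclicTwoOddPrimes.isPrimitive_iff (φ₀ := φ₀) Φ φh

/-- **Lower bound for the degenerate primitive types**: at least one CM type of `K` is primitive and degenerate as
soon as `k ≥ 2` (the explicit types of `DegenerateCMTypesCyclicCMFieldPrimePowerExistence`), and the nondegenerate
types are at most `2^{p^k} − 2^{p^{k−1}}`. [cite: Dodson1987, Prop. 4.4 (1) and Remark 4.5] -/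
theorem exists_isPrimitive_not_isNondegenerate (hp2 : p ≠ 2) (hρ : ∀ x, φ₀ (ρ x) = starRingEnd ℂ (φ₀ x))
    (hσ : orderOf σ = p ^ k) (hK : Module.finrank ℚ K = 2 * p ^ k) (hk : 2 ≤ k) :
    ∃ Φ : CMType K, (∀ φh : K →+* ℂ, IsPrimitive (ℂ ≃+* ℂ) Φ.1 φh) ∧ ¬ IsNondegenerate Φ ∧
      cmTypeRank Φ = p ^ k - p ^ (k - 1) + 2 := by
  obtain ⟨m, rfl⟩ : ∃ m, k = m + 1 + 1 := ⟨k - 2, by omega⟩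
  obtain ⟨Φ, hprim, hrank, -⟩ := exists_isPrimitive_cmTypeRank_eq_min hp2 hρ hσ hK
  refine ⟨Φ, hprim, ?_, by rw [hrank, Nat.add_sub_cancel]⟩
  rw [_root_.Literature.AlgebraicGeometry.Pohlmann1968.isNondegenerate_iff, finrank_div_two_eq hK]
  have hlt : cmTypeRank Φ < p ^ (m + 1 + 1) + 1 := by
    rw [hrank]
    have h1 : p ≤ p ^ (m + 1) := Nat.le_self_pow (Nat.succ_ne_zero m) p
    have hp3 : 3 ≤ p := by have := hp.out.two_le; omega
    have h3 : 3 * p ^ (m + 1) ≤ p ^ (m + 1 + 1) := by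
      rw [pow_succ p (m + 1), mul_comm (p ^ (m + 1)) p]
      exact Nat.mul_le_mul_right _ hp3
    omega
  exact hlt.ne

end Counts

/-! ## §2 Cyclic Galois groups of order `2p^k`, degree `54`, `ℚ(ζ₈₁)` -/

section Cyclic

open Literature.AlgebraicGeometry.ComplexMultiplication.CyclicTwoPower (exists_conj_gal)

variable {K : Type} [Field K] [NumberField K] [IsCMField K] [Normal ℚ K] {p : ℕ}

omit [IsCMField K] [Normal ℚ K] in
/-- A cyclic Galois group is commutative. [folklore] -/
private theorem comm_of_isCyclic (hcyc : IsCyclic (K ≃ₐ[ℚ] K)) : ∀ g h : K ≃ₐ[ℚ] K, g * h = h * g := by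
  obtain ⟨γ, hγ⟩ := hcyc.exists_generator
  intro g h
  obtain ⟨a, rfl⟩ := Subgroup.mem_zpowers_iff.1 (hγ g)
  obtain ⟨b, rfl⟩ := Subgroup.mem_zpowers_iff.1 (hγ h)
  rw [← zpow_add, ← zpow_add, add_comm]

/-- **CM fields with CYCLIC Galois group of order `2p^k` (`k = m + 1`): `2^{p^k}` CM types, `2^{p^{k−1}}`
non-primitive, `2^{p^k} − 2^{p^{k−1}}` primitive.** [cite: Dodson1987, Prop. 4.4 (1)] [cite: Shimura1998, §8.2 Prop. 26] -/
theorem counts_of_isCyclic (hcyc : IsCyclic (K ≃ₐ[ℚ] K)) (hp : p.Prime) (hp2 : p ≠ 2) {m : ℕ}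
    (hK : Module.finrank ℚ K = 2 * p ^ (m + 1)) (φh : K →+* ℂ) :
    (Set.univ : Set (CMType K)).ncard = 2 ^ (p ^ (m + 1)) ∧
      {Φ : CMType K | ¬ IsPrimitive (ℂ ≃+* ℂ) Φ.1 φh}.ncard = 2 ^ (p ^ m) ∧
      {Φ : CMType K | IsPrimitive (ℂ ≃+* ℂ) Φ.1 φh}.ncard = 2 ^ (p ^ (m + 1)) - 2 ^ (p ^ m) := by
  haveI : Fact p.Prime := ⟨hp⟩
  haveI : IsMulCommutative (K ≃ₐ[ℚ] K) := ⟨⟨comm_of_isCyclic hcyc⟩⟩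
  obtain ⟨ρ, hρall⟩ := exists_conj_gal (K := K)
  obtain ⟨σ, hσ⟩ := exists_orderOf_eq_pow hcyc φh hK
  exact ⟨ncard_cmType hp2 (hρall φh) hσ hK, ncard_not_isPrimitive hp2 (hρall φh) hσ hK φh,
    ncard_isPrimitive hp2 (hρall φh) hσ hK φh⟩

/-- **Degree `54`: `134217728 = 2²⁷` CM types, `512` non-primitive, `134217216` primitive** (each primitive one the
type of simple abelian `27`-folds, of rank `28, 26, 22` or `20`). [cite: Dodson1987, Prop. 4.4 (1) and Remark 4.5] -/
theorem counts_of_isCyclic_fiftyFour (hcyc : IsCyclic (K ≃ₐ[ℚ] K)) (hK : Module.finrank ℚ K = 54)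
    (φh : K →+* ℂ) :
    (Set.univ : Set (CMType K)).ncard = 134217728 ∧
      {Φ : CMType K | ¬ IsPrimitive (ℂ ≃+* ℂ) Φ.1 φh}.ncard = 512 ∧
      {Φ : CMType K | IsPrimitive (ℂ ≃+* ℂ) Φ.1 φh}.ncard = 134217216 := by
  have hK' : Module.finrank ℚ K = 2 * 3 ^ (2 + 1) := by rw [hK]; norm_num
  obtain ⟨h1, h2, h3⟩ := counts_of_isCyclic hcyc Nat.prime_three (by norm_num) hK' φh
  refine ⟨by rw [h1]; norm_num, by rw [h2]; norm_num, by rw [h3]; norm_num⟩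

/-- **`ℚ(ζ₈₁)`: `2²⁷` CM types, `512` non-primitive, `134217216` primitive.** [cite: Dodson1987, Prop. 4.4 (1)]
[cite: Washington1997, Thm. 2.5] -/
theorem counts_eightyOne (L : Type) [Field L] [NumberField L] [IsCyclotomicExtension {81} ℚ L] (φh : L →+* ℂ) :
    (Set.univ : Set (CMType L)).ncard = 134217728 ∧
      {Φ : CMType L | ¬ IsPrimitive (ℂ ≃+* ℂ) Φ.1 φh}.ncard = 512 ∧
      {Φ : CMType L | IsPrimitive (ℂ ≃+* ℂ) Φ.1 φh}.ncard = 134217216 := by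
  obtain ⟨hcm, hno, hcyc, hK⟩ := cm_normal_cyclic_finrank_eightyOne L
  haveI := hcm
  haveI := hno
  exact counts_of_isCyclic_fiftyFour hcyc hK φh

end Cyclic

end CyclicPrimePower

end Literature.AlgebraicGeometry.Pohlmann1968
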